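import Summits.BirchSwinnertonDyer.BirchSwinnertonDyer.Theses.VerticalContact
import Summits.BirchSwinnertonDyer.BirchSwinnertonDyer.Theses.SelmerRank
import Literature.NumberTheory.EllipticCurves.KatoRankBound
import Literature.NumberTheory.EllipticCurves.BSDSelmerParityDokchitserProofs
import HarnessLib

/-!
# BirchSwinnertonDyer / VerticalContact — crux `PGSelmerBSD` (stmt-BirchSwinnertonDyer-17810), line `Sketch`:
# the transfer theorem (the crux from ONE λ-minimal prime, modulo named facts and sibling items)

Line `Sketch` of the crux (lead's skeleton `Cruxes/PGSelmerBSD/Lines/Sketch.lean`, crux idea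
`lambda-minimal-free-prime`) spends the crux's unconditioned `∃ p` on ONE admissible prime at which the
Mazur–Tate–Teitelbaum `p`-adic `L`-function has no excess zero at `T = 0`. This file is the line's TRANSFER
theorem, kernel-checked in the tree: the crux `VerticalContact.PGSelmerBSD` follows from

* the transfer target C⁺ (`FreeOrderMinimalPrime`, registered stub `stub_freeOrderMinimalPrime`, stated inline as
  the hypothesis `hC`): every non-CM curve of the sector with `r_an ≥ 2` has an admissible prime `p` (`p ≥ 5` good
  ordinary, `ρ̄_{E,p}` surjective) with `ord_{T=0} L_p(f,α,T) ≤ r_an` for every newform `f` of the curve;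
* three NAMED FACTS of the literature, by name: Gross–Zagier–Kolyvagin (bsd.S17,
  `rank_eq_analyticRank_of_analyticRank_le_one`), modularity (`exists_isNewformOf`, BCDT 2001 Thm A) and Kato's bound
  `corank_{ℤ_p} Sel_{p^∞} ≤ ord_{T=0} L_p` (Kato 2004 Thm 18.4, `kato_selmerCorank_le_order_padicLFunction`);
* two sibling ITEMS by name: `VerticalContact.SelmerRankLB` (stmt-0131) and `SelmerRank.SelmerRankCM` (stmt-18086).

Cells: `r_an ≤ 1` by GZK at any prime (`selmerCorank_eq_analyticRank_of_analyticRank_le_one`, proved); CM with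
`r_an ≥ 2` by the CM item at a good ordinary prime (`exists_good_ordinary_prime_holds`, proved); non-CM with
`r_an ≥ 2` at the prime of C⁺: `corank_p ≤ ord_T L_p ≤ r_an` (Kato, C⁺, the newform from modularity with
`NeZero N_E` from `conductorNorm_pos_holds`) and `r_an ≤ corank_p` (LB item). Nothing is restated: facts and items
enter by name, C⁺ verbatim as registered.
-/

set_option linter.dupNamespace false

open scoped MatrixGroups ModularForm

open CongruenceSubgroup Literature.NumberTheory.EllipticCurves.ModularForms

namespace Summit.BirchSwinnertonDyer.BirchSwinnertonDyer.Theorems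

open Summit.BirchSwinnertonDyer.BirchSwinnertonDyer.Theses
open Literature.NumberTheory.EllipticCurves

/-- **Transfer theorem of line `Sketch` (crux `PGSelmerBSD`).** Granting Gross–Zagier–Kolyvagin (bsd.S17),
modularity (BCDT Thm A) and Kato's Thm 18.4 as the tree's named facts, the transfer target C⁺ (one admissible
prime with `ord_{T=0} L_p ≤ r_an` for every non-CM sector curve of analytic rank `≥ 2`) together with the items
`VerticalContact.SelmerRankLB` (stmt-0131) and `SelmerRank.SelmerRankCM` (stmt-18086) gives the crux
`VerticalContact.PGSelmerBSD` by name. CONDITIONAL on the three facts; C⁺ and the two items are open.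
[cite: Kato2004Asterisque, Thm. 18.4 (p. 281)] -/
theorem pgSelmerBSD_of_freeOrderMinimalPrime_of_facts : Literature.NumberTheory.EllipticCurves.rank_eq_analyticRank_of_analyticRank_le_one → Literature.NumberTheory.EllipticCurves.ModularForms.exists_isNewformOf → (∀ (W : WeierstrassCurve ℚ) [W.IsElliptic] [W.IsGloballyMinimal] (p : ℕ) [Fact p.Prime] {N : ℕ} [NeZero N] {f : CuspForm (Gamma0 N) 2}, Literature.NumberTheory.EllipticCurves.kato_selmerCorank_le_order_padicLFunction W p (f := f)) → (∀ (W : WeierstrassCurve ℚ) [W.IsElliptic] [W.IsGloballyMinimal], (¬ ∃ (q : ℕ) (_ : Fact q.Prime), W.HasMultiplicativeReductionAtPrime q) → ¬ W.HasCM → 2 ≤ W.analyticRank → ∃ (p : ℕ) (_ : Fact p.Prime), (5 ≤ p ∧ W.HasGoodReductionAtPrime p ∧ ¬ (p : ℤ) ∣ W.frobeniusTrace p ∧ W.HasSurjectiveModNGaloisRep p) ∧ ∀ {N : ℕ} [NeZero N] (f : CuspForm (Gamma0 N) 2), IsNewformOf W f → (padicLFunction f (unitRoot W p : ℚ_[p])).order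 ≤ W.analyticRank) → Summit.BirchSwinnertonDyer.BirchSwinnertonDyer.Theses.VerticalContact.SelmerRankLB → Summit.BirchSwinnertonDyer.BirchSwinnertonDyer.Theses.SelmerRank.SelmerRankCM → Summit.BirchSwinnertonDyer.BirchSwinnertonDyer.Theses.VerticalContact.PGSelmerBSD := by
  intro hGZK hmod hKato hC hLB hCM W _ _ hsec
  by_cases hr : W.analyticRank ≤ 1
  · exact ⟨2, ⟨Nat.prime_two⟩, selmerCorank_eq_analyticRank_of_analyticRank_le_one hGZK W 2 hr⟩
  by_cases hW : W.HasCM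
  · obtain ⟨p, hp, h5, hgood, hord⟩ := WeierstrassCurve.exists_good_ordinary_prime_holds W
    exact ⟨p, hp, hCM W p h5 hgood hord hW⟩
  · obtain ⟨p, hp, ⟨h5, hgood, hord, hsurj⟩, hCp⟩ := hC W hsec hW (by omega)
    haveI : NeZero (W.conductorNorm ℤ) := ⟨(W.conductorNorm_pos_holds).ne'⟩
    obtain ⟨f, hf⟩ := hmod W
    have hub : (W.selmerCorank p : ℕ∞) ≤ (W.analyticRank : ℕ∞) :=
      (hKato W p (by omega) ⟨hgood, hord⟩ hf).trans (hCp f hf)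
    exact ⟨p, hp, le_antisymm (by exact_mod_cast hub) (hLB W p h5 hgood hord hsurj)⟩

end Summit.BirchSwinnertonDyer.BirchSwinnertonDyer.Theorems
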